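import Mathlib
import Literature.Analysis.FluidPDE.SelfSimilarEulerProfile
import Summits.NavierStokesRegularity.NavierStokesRegularity.Theorems.EulerZoomLiouvillePowerGaugeEulerLiouvilleOutflowDive
import HarnessLib

/-!
# «THE NEEDLE LIVES IN THE SWIRL BAND» — corollary of «NO LONG OUTFLOW DIVES» for the binder `¬HasFastVorticalChannel`
# (crux `EulerZoomLiouville.PowerGaugeEulerLiouville` = stmt-NavierStokesRegularity-19832; line `outflow_dive` REV7 of ns-idea-11 g7; width seat ns-ezl-w3 g5)

Route `EulerZoomLiouville` (NavierStokesRegularity), crux E.  `(V, P′)` a classical self-similar Euler profile about `0` at the class rate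
`γ = 1/(2+ρ)`, `ρ ∈ (0, ½]`; `W y = γy + V y` (`selfSimilarTransport`), `ℋ` the self-similar Bernoulli function (`selfSimilarBernoulli`).

The line `Cruxes/PowerGaugeEulerLiouville/Lines/outflow_dive.lean` (REV7, commit deda0a2fa204) proves, over its closed dive lemma, the sorry-free
corollary `swirlBand_of_not_channel`; this file is its TAKEABLE tree copy over the LEAD's `OutflowDive.outflowDive` (`…OutflowDive.lean`), with the
line's `HasFastVorticalChannel` (= `Birth.HasFastVorticalChannel`, `Lines/birth.lean` v78) SPELLED OUT, in three readings:

* `OutflowDive.swirlBand_of_not_channel_above` — for ANY threshold `c⋆ ≥ 0`: if there is no one-sided fast vortical Bernoulli channel at any rate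
  `c₁ > c⋆`, then for every `c₁ > c⋆` some profile pressure `P′` and level `h` have, beyond EVERY radius, a Bernoulli-high vortical point in the
  SWIRL BAND `−c₁‖y‖² < ⟪y, W y⟫ ≤ c₁‖y‖²` (¬channel's far high vortical non-inflow witnesses: band ones kept, `c₁`-fast OUTFLOW ones sent to band
  points by the dive lemma, which holds at every rate `c₁ > 0`);
* `OutflowDive.swirlBand_of_not_channel` — the line's statement verbatim (threshold `c⋆ = 1/((2+ρ)(1+ρ))`, `Birth.HasFastVorticalChannel` v69/v78
  spelled out);
* `OutflowDive.slowBand_of_not_channel` — the v83 reading announced by the ideator (threshold `c⋆ = 0`: «the needle lives in the SLOW band»).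

WHAT THIS IS NOT: not NS, not E — pure logic over a class-free portrait lemma about `C²` profiles, `--supports` stmt-19832 (MODEL lattice; 19832 is a
crux CLASS (E/NS strata), not NS regularity); DENT 0 on the registered stubs; the crux is OPEN. [folklore; cf. ConstantinIgnatovaVicol2026Putative §3.4]
-/

noncomputable section

-- flat `Theorems/<Route><Decl>…` files of one crux share the namespace of the crux (tree convention: `Summit.<S>.<S>.…`)
set_option linter.dupNamespace false

open Set Filter Topology Metric

namespace Summit.NavierStokesRegularity.NavierStokesRegularity.Theorems.PowerGaugeEulerLiouville

open Literature.Analysis Literature.Analysis.FluidPDE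

namespace OutflowDive

/-- **«THE NEEDLE LIVES IN THE SWIRL BAND», any threshold `c⋆ ≥ 0`.**  If the profile `V` has no one-sided fast vortical Bernoulli channel at
any rate `c₁ > c⋆` — no `c₁ > c⋆` such that for every profile pressure `P′` and level `h`, beyond some radius every Bernoulli-high vortical point
is `c₁`-fast INFLOW (`⟪y, W y⟫ ≤ −c₁‖y‖²`) — then for every `c₁ > c⋆` there are a profile pressure `P′` and a level `h` such that beyond EVERY
radius there is a Bernoulli-high vortical point in the swirl band `−c₁‖y‖² < ⟪y, W y⟫ ≤ c₁‖y‖²`.  (The far high vortical non-inflow witnesses of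
¬channel that are `c₁`-fast outflow are converted by `outflowDive`.) [folklore; cf. ConstantinIgnatovaVicol2026Putative §3.4] -/
theorem swirlBand_of_not_channel_above (ρ : ℝ) (hρ : 0 < ρ) (hρh : ρ ≤ 1 / 2)
    (V : EuclideanSpace ℝ (Fin 3) → EuclideanSpace ℝ (Fin 3)) (cs : ℝ) (hcs : 0 ≤ cs)
    (hV : ¬ ∃ c₁ : ℝ, cs < c₁ ∧
      ∀ P' : EuclideanSpace ℝ (Fin 3) → ℝ, IsSelfSimilarEulerProfile (1 / (2 + ρ)) 0 V P' →
        ∀ h : ℝ, ∃ R₀ : ℝ, ∀ y : EuclideanSpace ℝ (Fin 3), R₀ ≤ ‖y‖ → h < selfSimilarBernoulli (1 / (2 + ρ)) 0 V P' y →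
          curl V y ≠ 0 → inner ℝ y (selfSimilarTransport (1 / (2 + ρ)) 0 V y) ≤ -(c₁ * ‖y‖ ^ 2)) :
    ∀ c₁ : ℝ, cs < c₁ →
      ∃ P' : EuclideanSpace ℝ (Fin 3) → ℝ, IsSelfSimilarEulerProfile (1 / (2 + ρ)) 0 V P' ∧
        ∃ h : ℝ, ∀ R₀ : ℝ, ∃ y : EuclideanSpace ℝ (Fin 3), R₀ ≤ ‖y‖ ∧
          h < selfSimilarBernoulli (1 / (2 + ρ)) 0 V P' y ∧ curl V y ≠ 0 ∧
          -(c₁ * ‖y‖ ^ 2) < inner ℝ y (selfSimilarTransport (1 / (2 + ρ)) 0 V y) ∧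
          inner ℝ y (selfSimilarTransport (1 / (2 + ρ)) 0 V y) ≤ c₁ * ‖y‖ ^ 2 := by
  intro c₁ hc₁
  classical
  have hcpos : 0 < c₁ := lt_of_le_of_lt hcs hc₁
  by_contra H
  apply hV
  refine ⟨c₁, hc₁, fun P' hP h => ?_⟩
  by_contra H'
  apply H
  refine ⟨P', hP, h, fun R₀ => ?_⟩
  -- the dive below radius `R₀`, at rate `c₁`, level `h`
  obtain ⟨R₂, hR₂⟩ := outflowDive ρ hρ hρh V P' hP c₁ hcpos h R₀
  -- a far high vortical point that is not `c₁`-fast inflow, beyond `max R₀ R₂`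
  have H'' : ∃ y : EuclideanSpace ℝ (Fin 3), max R₀ R₂ ≤ ‖y‖ ∧
      h < selfSimilarBernoulli (1 / (2 + ρ)) 0 V P' y ∧ curl V y ≠ 0 ∧
      ¬ inner ℝ y (selfSimilarTransport (1 / (2 + ρ)) 0 V y) ≤ -(c₁ * ‖y‖ ^ 2) := by
    by_contra Hn
    apply H'
    refine ⟨max R₀ R₂, fun y hy hh hcurl => ?_⟩
    by_contra hfast
    exact Hn ⟨y, hy, hh, hcurl, hfast⟩
  obtain ⟨y, hy, hh, hcurl, hnot⟩ := H''
  have hyR₀ : R₀ ≤ ‖y‖ := le_trans (le_max_left _ _) hy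
  have hyR₂ : R₂ ≤ ‖y‖ := le_trans (le_max_right _ _) hy
  by_cases hband : inner ℝ y (selfSimilarTransport (1 / (2 + ρ)) 0 V y) ≤ c₁ * ‖y‖ ^ 2
  · exact ⟨y, hyR₀, hh, hcurl, lt_of_not_ge hnot, hband⟩
  · -- `c₁`-fast OUTFLOW: dive to a swirl-band point below, above radius `R₀`
    obtain ⟨y', hy'R₀, -, hh', hcurl', hlow', hup'⟩ := hR₂ y hyR₂ hh hcurl (le_of_lt (lt_of_not_ge hband))
    exact ⟨y', hy'R₀, hh', hcurl', hlow', hup'⟩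

/-- **«THE NEEDLE LIVES IN THE SWIRL BAND»** — the statement of `OutflowDive.swirlBand_of_not_channel` of `Lines/outflow_dive.lean` REV7 with
`HasFastVorticalChannel ρ V` (= `Birth.HasFastVorticalChannel`, v69/v78: threshold `1/((2+ρ)(1+ρ)) < c₁`) spelled out: for `ρ ∈ (0, ½]`,
¬channel ⇒ for every `c₁ > 1/((2+ρ)(1+ρ))` some profile pressure `P′` and level `h` have, beyond every radius, a Bernoulli-high vortical point
with `−c₁‖y‖² < ⟪y, W y⟫ ≤ c₁‖y‖²`. [folklore; cf. ConstantinIgnatovaVicol2026Putative §3.4] -/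
theorem swirlBand_of_not_channel (ρ : ℝ) (hρ : 0 < ρ) (hρh : ρ ≤ 1 / 2)
    (V : EuclideanSpace ℝ (Fin 3) → EuclideanSpace ℝ (Fin 3))
    (hV : ¬ ∃ c₁ : ℝ, 1 / ((2 + ρ) * (1 + ρ)) < c₁ ∧
      ∀ P' : EuclideanSpace ℝ (Fin 3) → ℝ, IsSelfSimilarEulerProfile (1 / (2 + ρ)) 0 V P' →
        ∀ h : ℝ, ∃ R₀ : ℝ, ∀ y : EuclideanSpace ℝ (Fin 3), R₀ ≤ ‖y‖ → h < selfSimilarBernoulli (1 / (2 + ρ)) 0 V P' y →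
          curl V y ≠ 0 → inner ℝ y (selfSimilarTransport (1 / (2 + ρ)) 0 V y) ≤ -(c₁ * ‖y‖ ^ 2)) :
    ∀ c₁ : ℝ, 1 / ((2 + ρ) * (1 + ρ)) < c₁ →
      ∃ P' : EuclideanSpace ℝ (Fin 3) → ℝ, IsSelfSimilarEulerProfile (1 / (2 + ρ)) 0 V P' ∧
        ∃ h : ℝ, ∀ R₀ : ℝ, ∃ y : EuclideanSpace ℝ (Fin 3), R₀ ≤ ‖y‖ ∧
          h < selfSimilarBernoulli (1 / (2 + ρ)) 0 V P' y ∧ curl V y ≠ 0 ∧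
          -(c₁ * ‖y‖ ^ 2) < inner ℝ y (selfSimilarTransport (1 / (2 + ρ)) 0 V y) ∧
          inner ℝ y (selfSimilarTransport (1 / (2 + ρ)) 0 V y) ≤ c₁ * ‖y‖ ^ 2 :=
  swirlBand_of_not_channel_above ρ hρ hρh V (1 / ((2 + ρ) * (1 + ρ))) (by positivity) hV

/-- **«THE NEEDLE LIVES IN THE SLOW BAND»** — the v83 reading (channel threshold `0 < c₁`): if there is no one-sided fast vortical Bernoulli
channel at any positive rate, then for every `c₁ > 0` some profile pressure `P′` and level `h` have, beyond every radius, a Bernoulli-high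
vortical RADIALLY SLOW point: `|⟪y, W y⟫| ≤ c₁‖y‖²` (indeed `−c₁‖y‖² < ⟪y, W y⟫ ≤ c₁‖y‖²`). [folklore; cf. ConstantinIgnatovaVicol2026Putative §3.4] -/
theorem slowBand_of_not_channel (ρ : ℝ) (hρ : 0 < ρ) (hρh : ρ ≤ 1 / 2)
    (V : EuclideanSpace ℝ (Fin 3) → EuclideanSpace ℝ (Fin 3))
    (hV : ¬ ∃ c₁ : ℝ, 0 < c₁ ∧
      ∀ P' : EuclideanSpace ℝ (Fin 3) → ℝ, IsSelfSimilarEulerProfile (1 / (2 + ρ)) 0 V P' →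
        ∀ h : ℝ, ∃ R₀ : ℝ, ∀ y : EuclideanSpace ℝ (Fin 3), R₀ ≤ ‖y‖ → h < selfSimilarBernoulli (1 / (2 + ρ)) 0 V P' y →
          curl V y ≠ 0 → inner ℝ y (selfSimilarTransport (1 / (2 + ρ)) 0 V y) ≤ -(c₁ * ‖y‖ ^ 2)) :
    ∀ c₁ : ℝ, 0 < c₁ →
      ∃ P' : EuclideanSpace ℝ (Fin 3) → ℝ, IsSelfSimilarEulerProfile (1 / (2 + ρ)) 0 V P' ∧
        ∃ h : ℝ, ∀ R₀ : ℝ, ∃ y : EuclideanSpace ℝ (Fin 3), R₀ ≤ ‖y‖ ∧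
          h < selfSimilarBernoulli (1 / (2 + ρ)) 0 V P' y ∧ curl V y ≠ 0 ∧
          |inner ℝ y (selfSimilarTransport (1 / (2 + ρ)) 0 V y)| ≤ c₁ * ‖y‖ ^ 2 := by
  intro c₁ hc₁
  obtain ⟨P', hP, h, hfar⟩ := swirlBand_of_not_channel_above ρ hρ hρh V 0 le_rfl hV c₁ hc₁
  refine ⟨P', hP, h, fun R₀ => ?_⟩
  obtain ⟨y, hy, hh, hcurl, hlow, hup⟩ := hfar R₀
  exact ⟨y, hy, hh, hcurl, abs_le.2 ⟨hlow.le, hup⟩⟩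

end OutflowDive

end Summit.NavierStokesRegularity.NavierStokesRegularity.Theorems.PowerGaugeEulerLiouville

end
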